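import Mathlib.RingTheory.DedekindDomain.Factorization
import Mathlib.NumberTheory.NumberField.DedekindZeta
import Mathlib.NumberTheory.EulerProduct.DirichletLSeries
import Mathlib.Analysis.Normed.Module.FiniteDimension
import Mathlib.Analysis.Normed.Ring.InfiniteSum
import Mathlib.Analysis.SpecificLimits.Normed
import Literature.NumberTheory.LFunctions.DedekindZeta
import HarnessLib

/-!
# Discharges of named facts in `DedekindZeta.lean`: the Euler product of the Dedekind zeta function

D-0014 keeps `Literature/` sorry-free by stating cited results as named facts `def X : Prop`.
This sibling file proves the named fact `Literature.NumberTheory.LFunctions.hasProd_dedekindEulerFactor` of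
`Literature.NumberTheory.LFunctions.DedekindZeta` (Neukirch, *Algebraic Number Theory*, Ch. VII,
(5.2) Proposition: for `Re(s) > 1`, `ζ_K(s) = ∏_𝔭 (1 - 𝔑(𝔭)^{-s})⁻¹`, the product over the
nonzero prime ideals of `𝓞 K`), as
`Literature.hasProd_dedekindEulerFactor_holds : hasProd_dedekindEulerFactor` (an unconditional product,
Mathlib `HasProd`, indexed by `IsDedekindDomain.HeightOneSpectrum (𝓞 K)` and converging to
Mathlib's Dirichlet series `NumberField.dedekindZeta K s`).  It is consumed by
`Literature.NumberTheory.GaloisRepresentations.artinLFunction_trivial_eq_dedekindZeta` (`GaloisRepresentations/ArtinLFunction.lean`,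
Neukirch VII (10.4)(i)).

## Mathlib search

Mathlib (this pin) proves Euler products only for functions on `ℕ`
(`Mathlib/NumberTheory/EulerProduct/Basic.lean`: `EulerProduct.eulerProduct_hasProd`, via
`Nat.factoredNumbers`; `DirichletLSeries.lean`: `riemannZeta_eulerProduct_hasProd`,
`DirichletCharacter.LSeries_eulerProduct_hasProd`), and has `NumberField.dedekindZeta` only as
the `LSeries` of `n ↦ #{I | N(I) = n}` (no Euler product: grep `dedekindZeta`, `EulerProduct`,
`HeightOneSpectrum` in `Mathlib/NumberTheory`).  It does have everything about factorisation of
ideals in a Dedekind domain that is needed (`Ideal.finprod_heightOneSpectrum_factorization`,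
`FractionalIdeal.count_finsuppProd`, `FractionalIdeal.count_coe`), the finiteness of the ideals
of given norm (`Ideal.finite_setOf_absNorm_eq`) and the completely multiplicative summand
`riemannZetaSummandHom : ℕ →*₀ ℂ`, `n ↦ n ^ (-s)`.

## Proof architecture

Neukirch proves (5.2) by reference to Euler's identity for `ζ(s)` (Ch. VII, (1.1)), whose
printed proof is: expand each factor `(1 - p^{-s})⁻¹ = ∑_ν p^{-νs}`; for finitely many primes
`p₁, …, p_r` the product of these absolutely convergent series is
`∑_{ν₁,…,ν_r ≥ 0} (p₁^{ν₁} ⋯ p_r^{ν_r})^{-s} = ∑' n^{-s}` (formula (∗)), the sum over the `n`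
divisible only by the `pᵢ` — this is unique factorisation —, and the difference with `ζ(s)`
is a remainder of the absolutely convergent series `∑ n^{-σ}`, which tends to `0`.  We
formalise exactly this, in three layers.

1. `Literature.FinsuppEulerProduct` (abstract layer, any index type `ι`, values in a complete normed
   commutative ring `R`): for `F : ι → ℕ → R` with `F i 0 = 1` and
   `∑_{g : ι →₀ ℕ} ‖∏_i F i (g i)‖ < ∞`, the finite stage
   `∏_{i ∈ S} ∑'_k F i k = ∑'_{supp g ⊆ S} ∏_i F i (g i)`
   (`summable_and_hasSum_support_subset`, induction on `S` through the bijection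
   `ℕ × {supp g ⊆ S} ≃ {supp g ⊆ insert i S}`, `(k, g) ↦ g + k • eᵢ`, and the Cauchy product
   `HasSum.mul` of absolutely convergent series — the analogue of Mathlib's
   `EulerProduct.summable_and_hasSum_factoredNumbers_prod_filter_prime_tsum` with
   `Nat.factoredNumbers` replaced by exponent vectors), and the limit `hasProd_tsum`:
   `HasProd (fun i ↦ ∑' k, F i k) (∑' g, ∏_i F i (g i))` (the tail is controlled by
   `Summable.tsum_vanishing`); `hasProd_inv_one_sub` is the geometric case `F i k = x i ^ k`.
2. Unique factorisation as a bijection (any Dedekind domain `R`): `g ↦ ∏_v v ^ (g v)`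
   (`g.prod fun v k ↦ v.asIdeal ^ k`) is injective on `HeightOneSpectrum R →₀ ℕ`
   (`count_finsuppProd_asIdeal_pow`, `finsuppProd_asIdeal_pow_injective`, from Mathlib's
   `FractionalIdeal.count_finsuppProd`) with range the nonzero ideals
   (`exists_finsuppProd_asIdeal_pow_eq`, from `Ideal.finprod_heightOneSpectrum_factorization`);
   this is Neukirch, Ch. I, (3.3) Theorem.  The absolute norm being multiplicative,
   `N(∏ v^{g v})^{-s} = ∏_v (N(v)^{-s})^{g v}` (`absNorm_finsuppProd_cpow`).
3. The Dedekind zeta function as a sum over ideals (number field `K`, `re s > 1`):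
   `∑_I ‖N(I)^{-s}‖ < ∞` over *all* ideals of `𝓞 K` (`summable_norm_absNorm_cpow`; the zero
   ideal contributes `0^{-s} = 0`), by regrouping along the fibres of `N` (finite,
   `Ideal.finite_setOf_absNorm_eq`) and the convergence of the Dirichlet series
   (`Literature.NumberTheory.LFunctions.LSeriesSummable_dedekindZeta`); and `HasSum (fun I ↦ N(I)^{-s}) (dedekindZeta K s)`
   (`hasSum_absNorm_cpow`, Mathlib `HasSum.tsum_fiberwise`) — Neukirch's Definition (5.1),
   `ζ_K(s) = ∑_𝔞 𝔑(𝔞)^{-s}`, matched with Mathlib's `LSeries` definition.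

`hasProd_dedekindEulerFactor_holds` then transports layer 1 (with `x v = N(v)^{-s}`) along the
bijection of layer 2 (`Function.Injective.tsum_eq`) and evaluates the sum by layer 3.

## The two forms of ERH and the reduction to Hecke's existence theorem (section `Reduction`)

`DedekindZeta.lean` states the equivalence `Literature.NumberField.extendedRiemannHypothesis_iff' K`
of the strip form of ERH for the chosen continuation `dedekindZetaCont K` and the
continuation-agnostic form `ExtendedRiemannHypothesis' K` as a named fact.  Neukirch, Ch. VII §5
derives everything about the continued `ζ_K` from two inputs: the *existence* of a continuation
to `ℂ ∖ {1}` ((5.11) Corollary (i), Hecke's theorem, here the named fact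
`Literature.exists_isDedekindZetaContinuation K`) and its *uniqueness* (identity theorem, proved in
`DedekindZeta.lean` as `IsDedekindZetaContinuation.unique`).  The section `Reduction` proves
what needs uniqueness only — the discharge `IsDedekindZetaContinuation.eqOn_dedekindZetaCont_holds`
and the forward implication `ERH K → ERH' K`
(`NumberField.ExtendedRiemannHypothesis.extendedRiemannHypothesis'`) — and the
existence-conditional converse, whence `NumberField.extendedRiemannHypothesis_iff'_of_exists :
exists_isDedekindZetaContinuation K → extendedRiemannHypothesis_iff' K` and, Hecke's theorem for
`K = ℚ` being Riemann's (`exists_isDedekindZetaContinuation_rat`), the unconditional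
`NumberField.extendedRiemannHypothesis_iff'_rat`.  What remains for
`extendedRiemannHypothesis_iff'` in general is exactly (5.11) (i).

## References

* J. Neukirch, *Algebraic Number Theory*, Grundlehren 322, Springer 1999: Ch. I §3, (3.3)
  Theorem (unique factorisation of ideals); Ch. VII §1, (1.1) Proposition (Euler's identity and
  its proof, formula (∗)); Ch. VII §5, (5.1) Definition and (5.2) Proposition (Dedekind zeta
  function and its Euler product); (5.11) Corollary (i) (continuation of `ζ_K` to `ℂ ∖ {1}`,
  Hecke). [NeukirchANT1999]
* S. Lang, *Algebraic Number Theory*, 2nd ed., GTM 110, Springer 1994, Ch. VIII §2 (Euler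
  product for `ζ_K`).
-/

noncomputable section

open Finset Filter Topology IsDedekindDomain IsDedekindDomain.HeightOneSpectrum nonZeroDivisors
open NumberField

namespace Literature.NumberTheory.LFunctions

/-! ### Layer 1: an abstract Euler product over exponent vectors `ι →₀ ℕ`

Throughout, `{g : ι →₀ ℕ | g.support ⊆ S}` is the set of exponent vectors supported inside the
finite set `S` — the analogue of Mathlib's `Nat.factoredNumbers S`, i.e. the "`S`-smooth"
elements of the free commutative monoid on `ι` (Neukirch's `n` divisible only by
`p₁, …, p_r`, Ch. VII §1, proof of (1.1), formula (∗)). -/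

namespace FinsuppEulerProduct

variable {ι : Type*} {R : Type*} [NormedCommRing R]

/-- Only the zero vector is supported in `∅` (analogue of `Nat.factoredNumbers_empty`).
[folklore] -/
theorem setOf_support_subset_empty : {g : ι →₀ ℕ | g.support ⊆ (∅ : Finset ι)} = {0} := by
  ext g
  simp [Finset.subset_empty, Finsupp.support_eq_empty]

variable {F : ι → ℕ → R}

/-- Multiplicativity in the induction step: `∏_j F j ((g + k • eᵢ) j) = F i k * ∏_j F j (g j)`
when `i ∉ supp g` (analogue of `Nat.factoredNumbers.map_prime_pow_mul`). [folklore] -/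
theorem prod_add_single {i : ι} {g : ι →₀ ℕ} (hi : i ∉ g.support) (hF : ∀ i, F i 0 = 1)
    (k : ℕ) : (g + Finsupp.single i k).prod F = F i k * g.prod F := by
  classical
  rw [Finsupp.prod_add_index_of_disjoint, Finsupp.prod_single_index (hF i), mul_comm]
  refine Finset.disjoint_left.mpr fun j hj hj' => ?_
  have : j = i := Finset.mem_singleton.mp (Finsupp.support_single_subset hj')
  subst this
  exact hi hj

/-- Finite stage, `S = ∅`: the sum over `{g | supp g ⊆ ∅} = {0}` is the empty product `1`.
[folklore] -/
theorem summable_and_hasSum_support_subset_empty :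
    Summable (fun g : {g : ι →₀ ℕ | g.support ⊆ (∅ : Finset ι)} => ‖g.1.prod F‖) ∧
      HasSum (fun g : {g : ι →₀ ℕ | g.support ⊆ (∅ : Finset ι)} => g.1.prod F) 1 := by
  rw [setOf_support_subset_empty]
  refine ⟨(Set.finite_singleton (0 : ι →₀ ℕ)).summable (fun g => ‖g.prod F‖), ?_⟩
  have := hasSum_singleton (0 : ι →₀ ℕ) (fun g => g.prod F)
  rwa [Finsupp.prod_zero_index] at this

variable [CompleteSpace R]

/-- Finite stage, induction step: passing from `S` to `insert i S` (`i ∉ S`) multiplies the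
sum over `{g | supp g ⊆ S}` by the absolutely convergent series `∑' k, F i k`: Cauchy product
of absolutely convergent series (Mathlib `HasSum.mul`), transported along the bijection
`ℕ × {supp g ⊆ S} ≃ {supp g ⊆ insert i S}`, `(k, g) ↦ g + k • eᵢ`, with inverse
`g ↦ (g i, g.erase i)` (the analogue of Mathlib's `Nat.equivProdNatFactoredNumbers`,
`(e, n) ↦ p ^ e * n`).
Ref: Neukirch, *Algebraic Number Theory*, Ch. VII §1, proof of (1.1), formula (∗). [folklore] -/
theorem summable_and_hasSum_support_subset_insert [DecidableEq ι] (hF : ∀ i, F i 0 = 1)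
    {i : ι} {S : Finset ι} (hi : i ∉ S) (hsum : Summable fun k => ‖F i k‖) {a : R}
    (ih : Summable (fun g : {g : ι →₀ ℕ | g.support ⊆ S} => ‖g.1.prod F‖) ∧
      HasSum (fun g : {g : ι →₀ ℕ | g.support ⊆ S} => g.1.prod F) a) :
    Summable (fun g : {g : ι →₀ ℕ | g.support ⊆ insert i S} => ‖g.1.prod F‖) ∧
      HasSum (fun g : {g : ι →₀ ℕ | g.support ⊆ insert i S} => g.1.prod F)
        ((∑' k, F i k) * a) := by
  -- the bijection `ℕ × {supp g ⊆ S} ≃ {supp g ⊆ insert i S}`, `(k, g) ↦ g + k • eᵢ`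
  let e : ℕ × {g : ι →₀ ℕ | g.support ⊆ S} ≃ {g : ι →₀ ℕ | g.support ⊆ insert i S} :=
    { toFun := fun x => ⟨x.2.1 + Finsupp.single i x.1, by
        refine (Finsupp.support_add).trans (Finset.union_subset
          (x.2.2.trans (Finset.subset_insert _ _)) ?_)
        exact Finsupp.support_single_subset.trans (Finset.singleton_subset_iff.mpr
          (Finset.mem_insert_self _ _))⟩
      invFun := fun g => (g.1 i, ⟨g.1.erase i, by
        rw [Set.mem_setOf_eq, Finsupp.support_erase]
        exact Finset.subset_insert_iff.mp g.2⟩)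
      left_inv := fun x => by
        obtain ⟨k, g, hg⟩ := x
        have hgi' : i ∉ g.support := fun h => hi (hg h)
        have hgi : g i = 0 := Finsupp.notMem_support_iff.mp hgi'
        ext
        · simp [hgi]
        · simp only [Finsupp.erase_add, Finsupp.erase_single, add_zero]
          rw [Finsupp.erase_of_notMem_support hgi']
      right_inv := fun g => by
        ext : 1
        exact Finsupp.erase_add_single i g.1 }
  have he : ∀ x, ((e x : {g : ι →₀ ℕ | g.support ⊆ insert i S}) : ι →₀ ℕ) =
      x.2.1 + Finsupp.single i x.1 := fun x => rfl
  have hi' : ∀ x : ℕ × {g : ι →₀ ℕ | g.support ⊆ S}, i ∉ x.2.1.support :=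
    fun x h => hi (x.2.2 h)
  have h1 : (fun g : {g : ι →₀ ℕ | g.support ⊆ insert i S} => ‖g.1.prod F‖) ∘ e =
      fun x : ℕ × {g : ι →₀ ℕ | g.support ⊆ S} => ‖F i x.1 * x.2.1.prod F‖ := by
    funext x
    rw [Function.comp_apply, he, prod_add_single (hi' x) hF]
  have h2 : (fun g : {g : ι →₀ ℕ | g.support ⊆ insert i S} => g.1.prod F) ∘ e =
      fun x : ℕ × {g : ι →₀ ℕ | g.support ⊆ S} => F i x.1 * x.2.1.prod F := by
    funext x
    rw [Function.comp_apply, he, prod_add_single (hi' x) hF]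
  have h3 : Summable fun x : ℕ × {g : ι →₀ ℕ | g.support ⊆ S} => ‖F i x.1‖ * ‖x.2.1.prod F‖ :=
    Summable.mul_of_nonneg hsum ih.1 (fun n => norm_nonneg _) (fun n => norm_nonneg _)
  have h4 : ∀ x : ℕ × {g : ι →₀ ℕ | g.support ⊆ S},
      ‖F i x.1 * x.2.1.prod F‖ ≤ ‖F i x.1‖ * ‖x.2.1.prod F‖ :=
    fun x => norm_mul_le _ _
  have h5 : Summable fun x : ℕ × {g : ι →₀ ℕ | g.support ⊆ S} => ‖F i x.1 * x.2.1.prod F‖ :=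
    Summable.of_nonneg_of_le (fun x => norm_nonneg _) h4 h3
  have : T3Space R := inferInstance
  have h6 : HasSum (fun x : ℕ × {g : ι →₀ ℕ | g.support ⊆ S} => F i x.1 * x.2.1.prod F)
      ((∑' k, F i k) * a) := by
    apply hsum.of_norm.hasSum.mul ih.2
    -- term-mode `exact` here times out (cf. the same remark in Mathlib's `EulerProduct`)
    apply summable_mul_of_summable_norm hsum ih.1
  rw [← h1] at h5
  rw [← h2] at h6
  exact ⟨e.summable_iff.mp h5, e.hasSum_iff.mp h6⟩

/-- **Finite stage of the Euler product** (Neukirch's formula (∗)): for a finite set `S` of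
indices, `∏_{i ∈ S} ∑'_k F i k = ∑'_{supp g ⊆ S} ∏_i F i (g i)`, the right-hand side
converging absolutely; here `F i 0 = 1` and each `∑_k ‖F i k‖ < ∞`.
Ref: Neukirch, *Algebraic Number Theory*, Ch. VII §1, proof of (1.1), formula (∗); cf. Mathlib
`EulerProduct.summable_and_hasSum_factoredNumbers_prod_filter_prime_tsum`. [folklore] -/
theorem summable_and_hasSum_support_subset (hF : ∀ i, F i 0 = 1)
    (hsum : ∀ i, Summable fun k => ‖F i k‖) (S : Finset ι) :
    Summable (fun g : {g : ι →₀ ℕ | g.support ⊆ S} => ‖g.1.prod F‖) ∧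
      HasSum (fun g : {g : ι →₀ ℕ | g.support ⊆ S} => g.1.prod F) (∏ i ∈ S, ∑' k, F i k) := by
  classical
  induction S using Finset.induction with
  | empty =>
    rw [Finset.prod_empty]
    exact summable_and_hasSum_support_subset_empty
  | insert i S hi ih =>
    rw [Finset.prod_insert hi]
    exact summable_and_hasSum_support_subset_insert hF hi (hsum i) ih

omit [CompleteSpace R] in
/-- If `∑_g ‖∏_i F i (g i)‖ < ∞` then each `∑_k ‖F i k‖ < ∞` (restrict to `g = k • eᵢ`).
[folklore] -/
theorem summable_norm_apply (hF : ∀ i, F i 0 = 1)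
    (hsum : Summable fun g : ι →₀ ℕ => ‖g.prod F‖) (i : ι) : Summable fun k => ‖F i k‖ := by
  simpa [Function.comp_def, Finsupp.prod_single_index (hF i)] using
    hsum.comp_injective (Finsupp.single_injective i)

/-- **Abstract Euler product.**  Let `F : ι → ℕ → R` (values in a complete normed commutative
ring) satisfy `F i 0 = 1` and `∑_{g : ι →₀ ℕ} ‖∏_i F i (g i)‖ < ∞`.  Then the product
`∏_i ∑'_k F i k` converges unconditionally (Mathlib `HasProd`) to `∑'_g ∏_i F i (g i)`: by the
finite stage the partial product over `S` is the sum over `supp g ⊆ S`, and the complementary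
sum is a remainder of an absolutely convergent series (`Summable.tsum_vanishing`).
Ref: Neukirch, *Algebraic Number Theory*, Ch. VII §1, proof of (1.1) (last display); cf.
Mathlib `EulerProduct.eulerProduct_hasProd`. [folklore] -/
theorem hasProd_tsum (hF : ∀ i, F i 0 = 1)
    (hsum : Summable fun g : ι →₀ ℕ => ‖g.prod F‖) :
    HasProd (fun i => ∑' k, F i k) (∑' g : ι →₀ ℕ, g.prod F) := by
  classical
  rw [HasProd, SummationFilter.unconditional_filter, Metric.tendsto_atTop]
  intro ε hε
  obtain ⟨T, hT⟩ := hsum.of_norm.tsum_vanishing (Metric.ball_mem_nhds 0 hε)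
  refine ⟨T.biUnion Finsupp.support, fun S hS => ?_⟩
  rw [← (summable_and_hasSum_support_subset hF (summable_norm_apply hF hsum) S).2.tsum_eq,
    dist_comm, dist_eq_norm,
    ← hsum.of_norm.tsum_subtype_add_tsum_subtype_compl {g : ι →₀ ℕ | g.support ⊆ S},
    add_sub_cancel_left]
  refine mem_ball_zero_iff.mp (hT _ (Set.disjoint_left.mpr fun g hg hgT => hg ?_))
  exact (Finset.subset_biUnion_of_mem Finsupp.support hgT).trans hS

/-- **Abstract Euler product, completely multiplicative form** (values in a complete normed
field): if `∑_{g : ι →₀ ℕ} ‖∏_i (x i)^{g i}‖ < ∞` then `∏_i (1 - x i)⁻¹` converges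
unconditionally to `∑'_g ∏_i (x i)^{g i}` (each `‖x i‖ < 1`, geometric series
`tsum_geometric_of_norm_lt_one`).
Ref: Neukirch, *Algebraic Number Theory*, Ch. VII §1, (1.1); cf. Mathlib
`EulerProduct.eulerProduct_completely_multiplicative_hasProd`. [folklore] -/
theorem hasProd_inv_one_sub {𝕜 : Type*} [NormedField 𝕜] [CompleteSpace 𝕜] {x : ι → 𝕜}
    (hsum : Summable fun g : ι →₀ ℕ => ‖g.prod fun i k => x i ^ k‖) :
    HasProd (fun i => (1 - x i)⁻¹) (∑' g : ι →₀ ℕ, g.prod fun i k => x i ^ k) := by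
  have hF : ∀ i, (fun i k => x i ^ k) i 0 = 1 := fun i => pow_zero (x i)
  have h := hasProd_tsum hF hsum
  have heq : (fun i => ∑' k, (fun i k => x i ^ k) i k) = fun i => (1 - x i)⁻¹ :=
    funext fun i => tsum_geometric_of_norm_lt_one
      (summable_geometric_iff_norm_lt_one.mp (summable_norm_apply hF hsum i).of_norm)
  rwa [heq] at h

end FinsuppEulerProduct

/-! ### Layer 2: unique factorisation of ideals as a bijection with exponent vectors

For a Dedekind domain `R`, the map `g ↦ ∏_v v ^ (g v) = g.prod fun v k ↦ v.asIdeal ^ k` from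
exponent vectors `g : HeightOneSpectrum R →₀ ℕ` to ideals of `R` (cf. Mathlib
`FractionalIdeal.count_finsuppProd` for the fractional-ideal version with exponents in `ℤ`) is a
bijection onto the nonzero ideals: Neukirch, *Algebraic Number Theory*, Ch. I §3, (3.3)
Theorem. -/

section Ideals

variable {R : Type*} [CommRing R] [IsDedekindDomain R]

/-- `∏_v v ^ (g v) ≠ 0`.  Ref: Neukirch, *Algebraic Number Theory*, Ch. I §3. [folklore] -/
theorem finsuppProd_asIdeal_pow_ne_zero (g : HeightOneSpectrum R →₀ ℕ) :
    (g.prod fun v k => v.asIdeal ^ k) ≠ 0 := by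
  rw [Finsupp.prod, Finset.prod_ne_zero_iff]
  exact fun v _ => pow_ne_zero _ v.ne_bot

/-- The multiplicity of `v` in `∏_w w ^ (g w)` is `g v` (uniqueness of the factorisation;
Mathlib `FractionalIdeal.count_finsuppProd` and `FractionalIdeal.count_coe`).
Ref: Neukirch, *Algebraic Number Theory*, Ch. I §3, (3.3) Theorem.
[cite: NeukirchANT1999, Ch. I §3 (3.3) Theorem] -/
theorem count_finsuppProd_asIdeal_pow (v : HeightOneSpectrum R) (g : HeightOneSpectrum R →₀ ℕ) :
    (Associates.mk v.asIdeal).count (Associates.mk (g.prod fun v k => v.asIdeal ^ k)).factors =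
      g v := by
  have h := FractionalIdeal.count_finsuppProd (FractionRing R) v (g.mapRange Nat.cast Nat.cast_zero)
  rw [Finsupp.prod_mapRange_index (fun _ => zpow_zero _), Finsupp.mapRange_apply] at h
  simp only [zpow_natCast] at h
  have h' : ((g.prod fun v k => v.asIdeal ^ k : Ideal R) : FractionalIdeal R⁰ (FractionRing R)) =
      g.prod fun v k => (v.asIdeal : FractionalIdeal R⁰ (FractionRing R)) ^ k := by
    rw [← FractionalIdeal.coeIdealHom_apply, map_finsuppProd]
    simp only [map_pow, FractionalIdeal.coeIdealHom_apply]
  rw [← h', FractionalIdeal.count_coe _ _ (finsuppProd_asIdeal_pow_ne_zero g)] at h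
  exact_mod_cast h

/-- `g ↦ ∏_v v ^ (g v)` is injective (uniqueness of the prime factorisation).
Ref: Neukirch, *Algebraic Number Theory*, Ch. I §3, (3.3) Theorem.
[cite: NeukirchANT1999, Ch. I §3 (3.3) Theorem] -/
theorem finsuppProd_asIdeal_pow_injective :
    Function.Injective fun g : HeightOneSpectrum R →₀ ℕ => g.prod fun v k => v.asIdeal ^ k := by
  intro g₁ g₂ h
  ext v
  rw [← count_finsuppProd_asIdeal_pow v g₁, ← count_finsuppProd_asIdeal_pow v g₂]
  exact congrArg (fun I : Ideal R => (Associates.mk v.asIdeal).count (Associates.mk I).factors) h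

/-- Every nonzero ideal is `∏_v v ^ (g v)` for some `g` (existence of the prime factorisation;
Mathlib `Ideal.finprod_heightOneSpectrum_factorization`).
Ref: Neukirch, *Algebraic Number Theory*, Ch. I §3, (3.3) Theorem.
[cite: NeukirchANT1999, Ch. I §3 (3.3) Theorem] -/
theorem exists_finsuppProd_asIdeal_pow_eq {I : Ideal R} (hI : I ≠ 0) :
    ∃ g : HeightOneSpectrum R →₀ ℕ, (g.prod fun v k => v.asIdeal ^ k) = I := by
  classical
  let c : HeightOneSpectrum R → ℕ := fun v =>
    (Associates.mk v.asIdeal).count (Associates.mk I).factors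
  have hc : (Function.support c).Finite := by
    have := Filter.eventually_cofinite.mp (Associates.finite_factors hI)
    refine this.subset fun v hv => ?_
    simpa [c, Function.mem_support] using hv
  refine ⟨Finsupp.ofSupportFinite c hc, ?_⟩
  conv_rhs => rw [← Ideal.finprod_heightOneSpectrum_factorization hI]
  rw [Finsupp.prod,
    finprod_eq_prod_of_mulSupport_subset _ (s := (Finsupp.ofSupportFinite c hc).support) ?_]
  · rfl
  · intro v hv
    rw [Function.mem_mulSupport] at hv
    rw [Finset.mem_coe, Finsupp.mem_support_iff, Finsupp.ofSupportFinite_coe]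
    intro h0
    exact hv (by rw [maxPowDividing, show (Associates.mk v.asIdeal).count _ = c v from rfl, h0,
      pow_zero])

/-- The range of `g ↦ ∏_v v ^ (g v)` is the set of nonzero ideals.
Ref: Neukirch, *Algebraic Number Theory*, Ch. I §3, (3.3) Theorem.
[cite: NeukirchANT1999, Ch. I §3 (3.3) Theorem] -/
theorem mem_range_finsuppProd_asIdeal_pow_iff {I : Ideal R} :
    I ∈ Set.range (fun g : HeightOneSpectrum R →₀ ℕ => g.prod fun v k => v.asIdeal ^ k) ↔
      I ≠ 0 :=
  ⟨fun ⟨g, hg⟩ => hg ▸ finsuppProd_asIdeal_pow_ne_zero g, exists_finsuppProd_asIdeal_pow_eq⟩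

end Ideals

/-! ### Layer 3: the Dedekind zeta function as a sum over ideals, and the Euler product -/

section NumberField

variable (K : Type*) [Field K] [NumberField K]

/-- `N(∏_v v ^ (g v))^{-s} = ∏_v (N(v)^{-s}) ^ (g v)` for `s ≠ 0` (`n ↦ n^{-s}` is the
completely multiplicative `riemannZetaSummandHom`).
Ref: Neukirch, *Algebraic Number Theory*, Ch. VII §5, proof sketch of (5.2) ("because the
absolute norm is multiplicative"). [folklore] -/
theorem absNorm_finsuppProd_cpow {s : ℂ} (hs : s ≠ 0) (g : HeightOneSpectrum (𝓞 K) →₀ ℕ) :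
    ((Ideal.absNorm (g.prod fun v k => v.asIdeal ^ k) : ℕ) : ℂ) ^ (-s) =
      g.prod fun v k => (((Ideal.absNorm v.asIdeal : ℕ) : ℂ) ^ (-s)) ^ k := by
  let χ : Ideal (𝓞 K) →* ℂ :=
    (riemannZetaSummandHom hs).toMonoidHom.comp
      (Ideal.absNorm : Ideal (𝓞 K) →*₀ ℕ).toMonoidHom
  have hχ : ∀ I, χ I = ((Ideal.absNorm I : ℕ) : ℂ) ^ (-s) := fun I => rfl
  rw [← hχ, map_finsuppProd]
  simp only [map_pow]
  simp only [hχ]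

/-- **Absolute convergence of `∑_𝔞 𝔑(𝔞)^{-s}` for `re s > 1`**, as a sum over *all* ideals of
`𝓞 K` (the zero ideal contributes `‖0^{-s}‖ = 0`): regroup along the finite fibres of the norm
(`Ideal.finite_setOf_absNorm_eq`, `summable_sigma_of_nonneg`) and use the convergence of the
Dirichlet series `∑_n #{𝔞 | 𝔑(𝔞) = n} n^{-σ}` (`Literature.NumberTheory.LFunctions.LSeriesSummable_dedekindZeta`).
Ref: Neukirch, *Algebraic Number Theory*, Ch. VII §5, (5.2) Proposition (absolute convergence).
[cite: NeukirchANT1999, Ch. VII §5 (5.2) Proposition] -/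
theorem summable_norm_absNorm_cpow {s : ℂ} (hs : 1 < s.re) :
    Summable fun I : Ideal (𝓞 K) => ‖((Ideal.absNorm I : ℕ) : ℂ) ^ (-s)‖ := by
  have hre : (-s).re ≠ 0 := by simp only [Complex.neg_re, ne_eq, neg_eq_zero]; linarith
  simp only [Complex.norm_natCast_cpow_of_re_ne_zero _ hre, Complex.neg_re]
  -- reduce to the fibres of the norm map
  refine (Equiv.summable_iff (Equiv.sigmaFiberEquiv (Ideal.absNorm : Ideal (𝓞 K) → ℕ))).mp ?_
  have heq : ((fun I : Ideal (𝓞 K) => (Ideal.absNorm I : ℝ) ^ (-s.re)) ∘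
      (Equiv.sigmaFiberEquiv (Ideal.absNorm : Ideal (𝓞 K) → ℕ))) =
      fun x : Σ n : ℕ, {I : Ideal (𝓞 K) // Ideal.absNorm I = n} => (x.1 : ℝ) ^ (-s.re) := by
    funext x
    simp only [Function.comp_apply, Equiv.sigmaFiberEquiv_apply, x.2.2]
  rw [heq, summable_sigma_of_nonneg (fun x => by positivity)]
  constructor
  · intro n
    haveI : Finite {I : Ideal (𝓞 K) // Ideal.absNorm I = n} :=
      (Ideal.finite_setOf_absNorm_eq n).to_subtype
    exact Summable.of_finite
  · simp only [tsum_const, nsmul_eq_mul]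
    refine (summable_norm_iff.mpr (Literature.NumberTheory.LFunctions.LSeriesSummable_dedekindZeta (K := K) hs)).congr
      fun n => ?_
    rw [LSeries.norm_term_eq]
    split_ifs with hn
    · subst hn
      rw [Nat.cast_zero, Real.zero_rpow (by linarith), mul_zero]
    · rw [Complex.norm_natCast, Real.rpow_neg (Nat.cast_nonneg n), div_eq_mul_inv]

/-- **`ζ_K(s) = ∑_𝔞 𝔑(𝔞)^{-s}`** (Neukirch's definition (5.1)) as an unconditional sum over all
ideals of `𝓞 K` (the zero ideal contributes `0^{-s} = 0`) converging to Mathlib's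
`NumberField.dedekindZeta K s = LSeries (n ↦ #{𝔞 | 𝔑(𝔞) = n}) s`, for `re s > 1`
(Mathlib `HasSum.tsum_fiberwise` along the norm map, `tsum_const` on each finite fibre).
Ref: Neukirch, *Algebraic Number Theory*, Ch. VII §5, (5.1) Definition.
[cite: NeukirchANT1999, Ch. VII §5 (5.1) Definition] -/
theorem hasSum_absNorm_cpow {s : ℂ} (hs : 1 < s.re) :
    HasSum (fun I : Ideal (𝓞 K) => ((Ideal.absNorm I : ℕ) : ℂ) ^ (-s)) (dedekindZeta K s) := by
  have hs0 : -s ≠ 0 := neg_ne_zero.mpr fun h => by rw [h, Complex.zero_re] at hs; linarith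
  have hS := (summable_norm_absNorm_cpow K hs).of_norm
  have h1 := hS.hasSum.tsum_fiberwise (Ideal.absNorm : Ideal (𝓞 K) → ℕ)
  have h2 : HasSum (fun n : ℕ => ∑' I : ↥((Ideal.absNorm : Ideal (𝓞 K) → ℕ) ⁻¹' {n}),
      ((Ideal.absNorm I.1 : ℕ) : ℂ) ^ (-s)) (dedekindZeta K s) := by
    rw [dedekindZeta, LSeries]
    refine ((Literature.NumberTheory.LFunctions.LSeriesSummable_dedekindZeta (K := K) hs).hasSum).congr_fun fun n => ?_
    have : ∀ I : ↥((Ideal.absNorm : Ideal (𝓞 K) → ℕ) ⁻¹' {n}),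
        ((Ideal.absNorm I.1 : ℕ) : ℂ) ^ (-s) = (n : ℂ) ^ (-s) := fun I => by
      rw [show Ideal.absNorm I.1 = n from I.2]
    rw [tsum_congr this, tsum_const, LSeries.term_def]
    split_ifs with hn
    · subst hn
      rw [Nat.cast_zero, Complex.zero_cpow hs0, smul_zero]
    · rw [nsmul_eq_mul, Complex.cpow_neg, div_eq_mul_inv]
      rfl
  have h3 := hS.hasSum
  rwa [h1.unique h2] at h3

/-- **Discharge of `Literature.NumberTheory.LFunctions.hasProd_dedekindEulerFactor` (Euler product of the Dedekind zeta
function).**  For `re s > 1`, `∏_𝔭 (1 - 𝔑(𝔭)^{-s})⁻¹`, the product over the nonzero prime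
ideals `𝔭` of `𝓞 K` (`v : HeightOneSpectrum (𝓞 K)`, factors `Literature.dedekindEulerFactor K v s`),
converges unconditionally to `ζ_K(s) = NumberField.dedekindZeta K s`: the abstract Euler
product `FinsuppEulerProduct.hasProd_inv_one_sub` with `x v = 𝔑(v)^{-s}`, transported along
the bijection `g ↦ ∏_v v ^ (g v)` between exponent vectors and nonzero ideals (unique
factorisation, `finsuppProd_asIdeal_pow_injective`, `Function.Injective.tsum_eq`) and evaluated
by `hasSum_absNorm_cpow`.
Ref: Neukirch, *Algebraic Number Theory*, Ch. VII §5, (5.2) Proposition, with the proof of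
Ch. VII §1, (1.1); Lang, *Algebraic Number Theory*, Ch. VIII §2.
[cite: NeukirchANT1999, Ch. VII §5 (5.2) Proposition] -/
theorem hasProd_dedekindEulerFactor_holds : hasProd_dedekindEulerFactor (K := K) := by
  intro s hs
  have hs0 : s ≠ 0 := fun h => by rw [h, Complex.zero_re] at hs; linarith
  have hkey := absNorm_finsuppProd_cpow K hs0
  have hinj := finsuppProd_asIdeal_pow_injective (R := 𝓞 K)
  have hsumg : Summable fun g : HeightOneSpectrum (𝓞 K) →₀ ℕ =>
      ‖g.prod fun v k => (((Ideal.absNorm v.asIdeal : ℕ) : ℂ) ^ (-s)) ^ k‖ := by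
    simp only [← hkey]
    exact (summable_norm_absNorm_cpow K hs).comp_injective hinj
  have hP := FinsuppEulerProduct.hasProd_inv_one_sub hsumg
  have htsum : (∑' g : HeightOneSpectrum (𝓞 K) →₀ ℕ,
      g.prod fun v k => (((Ideal.absNorm v.asIdeal : ℕ) : ℂ) ^ (-s)) ^ k) = dedekindZeta K s := by
    simp only [← hkey]
    rw [hinj.tsum_eq (f := fun I : Ideal (𝓞 K) => ((Ideal.absNorm I : ℕ) : ℂ) ^ (-s)) ?_]
    · exact (hasSum_absNorm_cpow K hs).tsum_eq
    · intro I hI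
      refine mem_range_finsuppProd_asIdeal_pow_iff.mpr fun h => ?_
      rw [Function.mem_support, h, Submodule.zero_eq_bot, Ideal.absNorm_bot, Nat.cast_zero,
        Complex.zero_cpow (neg_ne_zero.mpr hs0)] at hI
      exact (hI rfl).elim
  rw [htsum] at hP
  exact hP

end NumberField

/-! ## Discharges resting on uniqueness alone, and the reduction of
`NumberField.extendedRiemannHypothesis_iff'` to Hecke's existence theorem

Neukirch, *ANT* VII §5 derives everything about the continued `ζ_K` from two inputs: the
*existence* of the continuation (Cor. VII.5.11 (i), Hecke) and its *uniqueness* (identity theorem).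
The facts below need only uniqueness, or are the existence-conditional forms; they isolate exactly
what `NumberField.extendedRiemannHypothesis_iff'` still requires, namely
`exists_isDedekindZetaContinuation K` (Hecke's theorem, Neukirch Cor. VII.5.11 (i)). -/

section Reduction

open Complex Set

variable {K : Type*} [Field K] [NumberField K]

/-- Discharge of `IsDedekindZetaContinuation.eqOn_dedekindZetaCont`, unconditionally: if `F` is a
continuation of `ζ_K` then a continuation exists, so the `epsilon`-chosen `dedekindZetaCont K` is
one (`Classical.epsilon_spec`), and `F` agrees with it off `s = 1` by the identity theorem
(`IsDedekindZetaContinuation.unique`; Neukirch, *ANT* VII §5 with Cor. VII.5.11 (i)). [folklore] -/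
theorem IsDedekindZetaContinuation.eqOn_dedekindZetaCont_holds :
    IsDedekindZetaContinuation.eqOn_dedekindZetaCont (K := K) :=
  fun {_} hF ↦ hF.unique (Classical.epsilon_spec (p := IsDedekindZetaContinuation K) ⟨_, hF⟩)

variable (K) in
/-- Hecke's existence theorem `exists_isDedekindZetaContinuation K` makes the chosen
`dedekindZetaCont K` a continuation of `ζ_K` (`Classical.epsilon_spec`; Neukirch, *ANT*
Cor. VII.5.11 (i)). [folklore] -/
theorem isDedekindZetaContinuation_dedekindZetaCont_of_exists
    (h : exists_isDedekindZetaContinuation K) : isDedekindZetaContinuation_dedekindZetaCont K :=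
  Classical.epsilon_spec h

variable (K) in
/-- Under Hecke's existence theorem, `dedekindZetaCont K` is holomorphic on `ℂ ∖ {1}`
(Neukirch, *ANT* Cor. VII.5.11 (i)). [folklore] -/
theorem differentiableOn_dedekindZetaCont_of_exists (h : exists_isDedekindZetaContinuation K) :
    differentiableOn_dedekindZetaCont K :=
  (isDedekindZetaContinuation_dedekindZetaCont_of_exists K h).differentiableOn

/-- Under Hecke's existence theorem, `dedekindZetaCont K s = NumberField.dedekindZeta K s` for
`Re s > 1` (Neukirch, *ANT* VII §5, Def. 5.1 with Cor. VII.5.11 (i)). [folklore] -/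
theorem dedekindZetaCont_eq_dedekindZeta_of_exists (h : exists_isDedekindZetaContinuation K) :
    dedekindZetaCont_eq_dedekindZeta (K := K) :=
  fun {_} hs ↦ (isDedekindZetaContinuation_dedekindZetaCont_of_exists K h).eqOn hs

/-- A point of the open critical strip is not the pole `s = 1`. [folklore] -/
theorem mem_compl_singleton_one_of_re_lt_one {s : ℂ} (h1 : s.re < 1) :
    s ∈ ({1}ᶜ : Set ℂ) := by
  rintro (h' : s = 1)
  rw [h', one_re] at h1
  exact lt_irrefl _ h1

variable (K) in
/-- **`ERH K → ERH' K`, unconditionally.** If the chosen continuation `dedekindZetaCont K` has all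
its critical-strip zeros on `Re s = 1/2`, then so does *every* continuation `F` of `ζ_K`: the
existence of `F` makes `dedekindZetaCont K` a continuation, and `F = dedekindZetaCont K` off
`s = 1` (`IsDedekindZetaContinuation.eqOn_dedekindZetaCont_holds`), in particular on the open
strip. (Uniqueness of analytic continuation; Neukirch, *ANT* VII §5.) [folklore] -/
theorem NumberField.ExtendedRiemannHypothesis.extendedRiemannHypothesis'
    (h : NumberField.ExtendedRiemannHypothesis K) : NumberField.ExtendedRiemannHypothesis' K := by
  intro F hF s hs h0 h1
  refine h s ?_ h0 h1
  rw [← IsDedekindZetaContinuation.eqOn_dedekindZetaCont_holds hF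
    (mem_compl_singleton_one_of_re_lt_one h1), hs]

variable (K) in
/-- **`ERH' K → ERH K` under Hecke's existence theorem**: `dedekindZetaCont K` is then one of the
continuations quantified over in `ERH' K` (Neukirch, *ANT* Cor. VII.5.11 (i)). [folklore] -/
theorem NumberField.ExtendedRiemannHypothesis'.extendedRiemannHypothesis_of_exists
    (hex : exists_isDedekindZetaContinuation K) (h : NumberField.ExtendedRiemannHypothesis' K) :
    NumberField.ExtendedRiemannHypothesis K :=
  h _ (isDedekindZetaContinuation_dedekindZetaCont_of_exists K hex)

variable (K) in
/-- **Reduction of `NumberField.extendedRiemannHypothesis_iff'` to Hecke's theorem.** Given the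
existence of a continuation of `ζ_K` to `ℂ ∖ {1}` (`exists_isDedekindZetaContinuation K`;
Hecke 1917, Neukirch, *ANT* Cor. VII.5.11 (i)), the two forms of ERH for `K` are equivalent; the
forward direction holds unconditionally
(`NumberField.ExtendedRiemannHypothesis.extendedRiemannHypothesis'`). [folklore] -/
theorem NumberField.extendedRiemannHypothesis_iff'_of_exists
    (hex : exists_isDedekindZetaContinuation K) : NumberField.extendedRiemannHypothesis_iff' K :=
  ⟨NumberField.ExtendedRiemannHypothesis.extendedRiemannHypothesis' K,
    NumberField.ExtendedRiemannHypothesis'.extendedRiemannHypothesis_of_exists K hex⟩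

/-- Discharge of `NumberField.extendedRiemannHypothesis_iff' K` for `K = ℚ`: here Hecke's
existence theorem is Riemann's (`exists_isDedekindZetaContinuation_rat`, via
`riemannZeta`; Neukirch, *ANT* Cor. VII.1.7). [folklore] -/
theorem NumberField.extendedRiemannHypothesis_iff'_rat :
    NumberField.extendedRiemannHypothesis_iff' ℚ :=
  NumberField.extendedRiemannHypothesis_iff'_of_exists ℚ exists_isDedekindZetaContinuation_rat

end Reduction

end Literature.NumberTheory.LFunctions
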